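import Mathlib.Topology.Algebra.Order.LiminfLimsup
import Literature.Analysis.FluidPDE.GalerkinEnergyBalance
import Literature.Analysis.FluidPDE.LongTimeAverageSubadditive
import Literature.Analysis.FluidPDE.LongTimeAverageNonneg
import Literature.Analysis.FluidPDE.TimeAverageMeasureBasic
import HarnessLib

/-!
# Energy balance of the Galerkin system with a steady force, II: long-time averages

Trunk: FluidKinetic (`Literature/Analysis/FluidPDE`).  Continuation of `GalerkinEnergyBalance.lean`: the
long-time-average consequences of the energy identity and of the absorbing ball for a global solution
`α` of the Galerkin system with constant force coefficients `g` on a frequency set without mean mode,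
`ν > 0` (Doering–Foias 2002, §2; Foias–Manley–Rosa–Temam 2001, Ch. IV App. B); `E, D, W` are the
explicit modal energy / dissipation / injected-power sums, `⟨·⟩_T`, `⟨·⟩⁺`, `⟨·⟩⁻` the tree's
`timeMean`, `longTimeAvgSup`, `longTimeAvgInf`.  Contents: bounded running means and
`(E(0) − E(T))/(2T) → 0`; the long-time balance `longTimeAvgInf_dissipation_eq` /
`longTimeAvgSup_dissipation_eq` (`⟨D⟩∓ = ⟨W⟩∓`); the energy row `timeMean_work_le` /
`longTimeAvgSup_work_le` (`⟨W⟩ ≤ G√⟨E⟩`); `le_sqrt_mul_sqrt_of_floor` (`⟨E⟩⁺ ≤ E₀ ∧ ⟨D⟩⁻ ≥ ε ⇒ ε ≤ G√E₀`);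
`window_of_cone` (a `liminf` floor `δ > 0` on the means of `D − λE` gives `⟨E⟩⁺ ≤ G²/λ²`, `⟨D⟩⁻ ≥ δ`,
via the abstract `limsup_le_and_le_liminf_of_cone`); generic `atTop` lemmas
`liminf_add_eq_of_tendsto_zero`, `limsup_add_eq_of_tendsto_zero`, `timeMean_sub`, `timeMean_const`,
`longTimeAvgSup_of_eq_const`, `longTimeAvgInf_of_eq_const`.  All folklore.  NOT here: invariant measures, lower
bounds on `⟨D⟩`.  References: Doering–Foias, JFM 467 (2002) §2 [DoeringFoias2002]; Foias–Manley–Rosa–Temam,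
*Navier–Stokes Equations and Turbulence* (2001) Ch. IV [FoiasManleyRosaTemam2001].
-/

open MeasureTheory Set Filter Topology
open scoped InnerProductSpace RealInnerProductSpace

noncomputable section

namespace Literature.Analysis.FluidPDE

/-! ## Two `atTop` bookkeeping lemmas -/

/-- A real `liminf` along `atTop` ignores an additive perturbation tending to `0` (bounded main term). [folklore] -/
theorem liminf_add_eq_of_tendsto_zero {a r : ℝ → ℝ} (hr : Tendsto r atTop (𝓝 0))
    (ha : IsBoundedUnder (· ≤ ·) atTop a) (ha' : IsBoundedUnder (· ≥ ·) atTop a) :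
    liminf (fun T => a T + r T) atTop = liminf a atTop := by
  have e : (fun T => a T + r T) = fun T => r T + a T := funext fun T => add_comm _ _
  rw [e]
  apply le_antisymm
  · calc liminf (fun T => r T + a T) atTop ≤ limsup r atTop + liminf a atTop :=
          liminf_add_le hr.isBoundedUnder_ge hr.isBoundedUnder_le ha' ha.isCoboundedUnder_ge
      _ = liminf a atTop := by rw [hr.limsup_eq, zero_add]
  · calc liminf a atTop = liminf r atTop + liminf a atTop := by rw [hr.liminf_eq, zero_add]
      _ ≤ liminf (fun T => r T + a T) atTop :=
          le_liminf_add hr.isBoundedUnder_ge hr.isBoundedUnder_le ha' ha.isCoboundedUnder_ge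

/-- A real `limsup` along `atTop` ignores an additive perturbation tending to `0` (bounded main term). [folklore] -/
theorem limsup_add_eq_of_tendsto_zero {a r : ℝ → ℝ} (hr : Tendsto r atTop (𝓝 0))
    (ha : IsBoundedUnder (· ≤ ·) atTop a) (ha' : IsBoundedUnder (· ≥ ·) atTop a) :
    limsup (fun T => a T + r T) atTop = limsup a atTop := by
  apply le_antisymm
  · calc limsup (fun T => a T + r T) atTop ≤ limsup a atTop + limsup r atTop :=
          limsup_add_le ha' ha hr.isBoundedUnder_ge.isCoboundedUnder_le hr.isBoundedUnder_le
      _ = limsup a atTop := by rw [hr.limsup_eq, add_zero]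
  · calc limsup a atTop = limsup a atTop + liminf r atTop := by rw [hr.liminf_eq, add_zero]
      _ ≤ limsup (fun T => a T + r T) atTop :=
          le_limsup_add ha ha'.isCoboundedUnder_le hr.isBoundedUnder_le hr.isBoundedUnder_ge

/-- **The cone-to-window bookkeeping on running means.**  Abstract form of "a `liminf` floor on the
means of `D − λE` bounds the energy means and the dissipation means": if eventually
`mΦ = mD − λ·mE`, `mD = mW + r` with `r → 0`, `mW ≤ √G₂ √mE`, `mE ≥ 0`, the means are suitably
bounded and `0 < δ ≤ liminf mΦ`, then `limsup mE ≤ G₂/λ²` and `δ ≤ liminf mD`. [folklore] -/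
theorem limsup_le_and_le_liminf_of_cone {mE mD mW mΦ r : ℝ → ℝ} {lam δ G2 : ℝ}
    (hlam : 0 < lam) (hδ : 0 < δ) (hG2 : 0 ≤ G2)
    (h1 : ∀ᶠ T in atTop, mΦ T = mD T - lam * mE T)
    (h2 : ∀ᶠ T in atTop, mD T = mW T + r T)
    (h3 : ∀ᶠ T in atTop, mW T ≤ Real.sqrt G2 * Real.sqrt (mE T))
    (h4 : ∀ᶠ T in atTop, 0 ≤ mE T)
    (hEb : IsBoundedUnder (· ≤ ·) atTop mE) (hΦb : IsBoundedUnder (· ≥ ·) atTop mΦ)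
    (hDb : IsBoundedUnder (· ≤ ·) atTop mD) (hr : Tendsto r atTop (𝓝 0))
    (hcone : δ ≤ liminf mΦ atTop) :
    limsup mE atTop ≤ G2 / lam ^ 2 ∧ δ ≤ liminf mD atTop := by
  have hEb' : IsBoundedUnder (· ≥ ·) atTop mE := ⟨0, Filter.eventually_map.2 h4⟩
  constructor
  · have hpos : ∀ᶠ T in atTop, 0 < mΦ T := eventually_lt_of_lt_liminf (hδ.trans_le hcone) hΦb
    have hev : ∀ᶠ T in atTop, lam * mE T ≤ Real.sqrt G2 * Real.sqrt (mE T) + r T := by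
      filter_upwards [h1, h2, h3, hpos] with T e1 e2 e3 e4
      linarith
    have hφ : Monotone fun x : ℝ => Real.sqrt G2 * Real.sqrt x :=
      fun x y hxy => mul_le_mul_of_nonneg_left (Real.sqrt_le_sqrt hxy) (Real.sqrt_nonneg _)
    have hφc : Continuous fun x : ℝ => Real.sqrt G2 * Real.sqrt x :=
      continuous_const.mul Real.continuous_sqrt
    obtain ⟨B, hB⟩ := hEb
    have hφEb : IsBoundedUnder (· ≤ ·) atTop fun T => Real.sqrt G2 * Real.sqrt (mE T) := by
      refine ⟨Real.sqrt G2 * Real.sqrt B, ?_⟩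
      rw [eventually_map] at hB ⊢
      exact hB.mono fun T hT => hφ hT
    have hφEb' : IsBoundedUnder (· ≥ ·) atTop fun T => Real.sqrt G2 * Real.sqrt (mE T) :=
      ⟨0, Filter.eventually_map.2 (Eventually.of_forall fun T =>
        mul_nonneg (Real.sqrt_nonneg _) (Real.sqrt_nonneg _))⟩
    have hlamb' : IsBoundedUnder (· ≥ ·) atTop fun T => lam * mE T :=
      ⟨0, Filter.eventually_map.2 (h4.mono fun T hT => mul_nonneg hlam.le hT)⟩
    have hm : Monotone fun x : ℝ => lam * x := fun x y hxy => mul_le_mul_of_nonneg_left hxy hlam.le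
    have hlamE : limsup (fun T => lam * mE T) atTop = lam * limsup mE atTop :=
      (hm.map_limsup_of_continuousAt mE (continuous_const.mul continuous_id).continuousAt ⟨B, hB⟩
        hEb'.isCoboundedUnder_le).symm
    have hmapφ : limsup (fun T => Real.sqrt G2 * Real.sqrt (mE T)) atTop =
        Real.sqrt G2 * Real.sqrt (limsup mE atTop) :=
      (hφ.map_limsup_of_continuousAt mE hφc.continuousAt ⟨B, hB⟩ hEb'.isCoboundedUnder_le).symm
    have hle : limsup (fun T => lam * mE T) atTop ≤
        limsup (fun T => Real.sqrt G2 * Real.sqrt (mE T) + r T) atTop :=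
      limsup_le_limsup hev hlamb'.isCoboundedUnder_le (isBoundedUnder_le_add hφEb hr.isBoundedUnder_le)
    rw [limsup_add_eq_of_tendsto_zero hr hφEb hφEb', hmapφ, hlamE] at hle
    -- `hle : lam * x ≤ √G2 * √x`, `x = limsup mE`
    have hx : 0 ≤ limsup mE atTop := le_limsup_of_frequently_le h4.frequently ⟨B, hB⟩
    set x := limsup mE atTop with hx_def
    have hsq : lam ^ 2 * x ^ 2 ≤ G2 * x := by
      have h := pow_le_pow_left₀ (by positivity) hle 2
      rwa [mul_pow, mul_pow, Real.sq_sqrt hG2, Real.sq_sqrt hx] at h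
    rw [le_div_iff₀ (by positivity)]
    rcases hx.eq_or_lt with h0 | hxpos
    · rw [← h0]; simpa using hG2
    · have h' : lam ^ 2 * x * x ≤ G2 * x := by nlinarith
      have := le_of_mul_le_mul_right h' hxpos
      linarith
  · have hev : ∀ᶠ T in atTop, mΦ T ≤ mD T := by
      filter_upwards [h1, h4] with T e1 e4
      nlinarith [mul_nonneg hlam.le e4]
    exact hcone.trans (liminf_le_liminf hev hΦb hDb.isCoboundedUnder_ge)

/-- Running means are additive up to sign: `⟨f − g⟩_T = ⟨f⟩_T − ⟨g⟩_T` for integrable `f, g`. [folklore] -/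
theorem timeMean_sub {f g : ℝ → ℝ} {T : ℝ} (hT : 0 ≤ T) (hf : IntegrableOn f (Ioc 0 T))
    (hg : IntegrableOn g (Ioc 0 T)) :
    timeMean (fun t => f t - g t) T = timeMean f T - timeMean g T := by
  unfold timeMean
  rw [intervalIntegral.integral_of_le hT, intervalIntegral.integral_of_le hT,
    intervalIntegral.integral_of_le hT, integral_sub hf hg, mul_sub]

/-! ## Constants are their own running and long-time means -/

/-- The running mean of a constant over `[0, T]`, `T > 0`, is the constant. [folklore] -/
theorem timeMean_const {c T : ℝ} (hT : 0 < T) : timeMean (fun _ => c) T = c := by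
  unfold timeMean
  rw [intervalIntegral.integral_const, smul_eq_mul, sub_zero, ← mul_assoc, inv_mul_cancel₀ hT.ne',
    one_mul]

/-- A function constant on `(0, ∞)` has that constant as `limsup` long-time average. [folklore] -/
theorem longTimeAvgSup_of_eq_const {f : ℝ → ℝ} {c : ℝ} (h : ∀ t, 0 < t → f t = c) :
    longTimeAvgSup f = c := by
  unfold longTimeAvgSup
  rw [limsup_congr ((eventually_gt_atTop (0 : ℝ)).mono fun T hT =>
    (timeMean_congr h hT.le).trans (timeMean_const (c := c) hT)), limsup_const]

/-- A function constant on `(0, ∞)` has that constant as `liminf` long-time average. [folklore] -/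
theorem longTimeAvgInf_of_eq_const {f : ℝ → ℝ} {c : ℝ} (h : ∀ t, 0 < t → f t = c) :
    longTimeAvgInf f = c := by
  unfold longTimeAvgInf
  rw [liminf_congr ((eventually_gt_atTop (0 : ℝ)).mono fun T hT =>
    (timeMean_congr h hT.le).trans (timeMean_const (c := c) hT)), liminf_const]

section Balance

open FunctionSpaces.Torus Torus

variable {d : Type*} [Fintype d] [DecidableEq d] {S : Finset (d → ℤ)} {ν : ℝ}
  {g c₀ : ↥S → EuclideanSpace ℂ d} {α : ℝ → ↥S → EuclideanSpace ℂ d}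

namespace IsGalerkinODESolution

/-! ### Bounds on the running means -/

/-- The running means of the energy are eventually bounded above. [folklore] -/
theorem isBoundedUnder_le_timeMean_energy (hα : IsGalerkinODESolution ν g c₀ α) (hν : 0 < ν)
    (hS : ∀ k ∈ S, -k ∈ S) (hS0 : (0 : d → ℤ) ∉ S) (hg : IsRealCoeff g) :
    IsBoundedUnder (· ≤ ·) atTop (timeMean fun t => ∑ k, ‖α t k‖ ^ 2) :=
  isBoundedUnder_le_timeMean fun t ht => by
    rw [abs_of_nonneg (energy_nonneg α t)]
    exact hα.energy_le_max hν hS hS0 hg ht.le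

omit [DecidableEq d] in
/-- The running means of the energy are eventually bounded below (by `0`). [folklore] -/
theorem isBoundedUnder_ge_timeMean_energy (α : ℝ → ↥S → EuclideanSpace ℂ d) :
    IsBoundedUnder (· ≥ ·) atTop (timeMean fun t => ∑ k, ‖α t k‖ ^ 2) :=
  isBoundedUnder_ge_timeMean_of_nonneg (energy_nonneg α)

/-- The running means of the injected power are eventually bounded above. [folklore] -/
theorem isBoundedUnder_le_timeMean_work (hα : IsGalerkinODESolution ν g c₀ α) (hν : 0 < ν)
    (hS : ∀ k ∈ S, -k ∈ S) (hS0 : (0 : d → ℤ) ∉ S) (hg : IsRealCoeff g) :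
    IsBoundedUnder (· ≤ ·) atTop (timeMean fun t => ∑ k, (inner ℂ (g k) (α t k)).re) :=
  isBoundedUnder_le_timeMean fun _ ht => hα.abs_work_le hν hS hS0 hg ht.le

/-- The running means of the injected power are eventually bounded below. [folklore] -/
theorem isBoundedUnder_ge_timeMean_work (hα : IsGalerkinODESolution ν g c₀ α) (hν : 0 < ν)
    (hS : ∀ k ∈ S, -k ∈ S) (hS0 : (0 : d → ℤ) ∉ S) (hg : IsRealCoeff g) :
    IsBoundedUnder (· ≥ ·) atTop (timeMean fun t => ∑ k, (inner ℂ (g k) (α t k)).re) :=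
  isBoundedUnder_ge_timeMean fun _ ht => hα.abs_work_le hν hS hS0 hg ht.le

/-- The running means of the dissipation are eventually bounded above. [folklore] -/
theorem isBoundedUnder_le_timeMean_dissipation (hα : IsGalerkinODESolution ν g c₀ α) (hν : 0 < ν)
    (hS : ∀ k ∈ S, -k ∈ S) (hS0 : (0 : d → ℤ) ∉ S) (hg : IsRealCoeff g) :
    IsBoundedUnder (· ≤ ·) atTop
      (timeMean fun t => ν * (4 * Real.pi ^ 2 * ∑ k : ↥S, freqNormSq (k : d → ℤ) * ‖α t k‖ ^ 2)) :=
  isBoundedUnder_le_timeMean fun t ht => by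
    rw [abs_of_nonneg (dissipation_nonneg hν.le α t)]
    exact hα.dissipation_le hν hS hS0 hg ht.le

omit [DecidableEq d] in
/-- The running means of the dissipation are eventually bounded below (by `0`), `ν ≥ 0`. [folklore] -/
theorem isBoundedUnder_ge_timeMean_dissipation (hν : 0 ≤ ν) (α : ℝ → ↥S → EuclideanSpace ℂ d) :
    IsBoundedUnder (· ≥ ·) atTop
      (timeMean fun t => ν * (4 * Real.pi ^ 2 * ∑ k : ↥S, freqNormSq (k : d → ℤ) * ‖α t k‖ ^ 2)) :=
  isBoundedUnder_ge_timeMean_of_nonneg (dissipation_nonneg hν α)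

/-! ### The long-time balance `⟨D⟩ = ⟨W⟩` -/

/-- The boundary term of the running-mean energy identity tends to zero:
`(E(0) − E(T))/(2T) → 0` (the energy stays in `[0, max (E 0) ρ_*]`). [folklore] -/
theorem tendsto_energy_sub_div (hα : IsGalerkinODESolution ν g c₀ α) (hν : 0 < ν)
    (hS : ∀ k ∈ S, -k ∈ S) (hS0 : (0 : d → ℤ) ∉ S) (hg : IsRealCoeff g) :
    Tendsto (fun T => ((∑ k, ‖α 0 k‖ ^ 2) - ∑ k, ‖α T k‖ ^ 2) / (2 * T)) atTop (𝓝 0) := by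
  set M : ℝ := max (∑ k, ‖α 0 k‖ ^ 2) ((∑ k, ‖g k‖ ^ 2) / (4 * Real.pi ^ 2 * ν) ^ 2) with hM
  have hM0 : 0 ≤ M := (energy_nonneg α 0).trans (le_max_left _ _)
  have hb : ∀ T, 0 < T → |((∑ k, ‖α 0 k‖ ^ 2) - ∑ k, ‖α T k‖ ^ 2) / (2 * T)| ≤ M / T := by
    intro T hT
    rw [abs_div, abs_of_pos (by positivity : (0 : ℝ) < 2 * T)]
    have h0 := hα.energy_le_max hν hS hS0 hg le_rfl
    have h1 := hα.energy_le_max hν hS hS0 hg hT.le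
    have h2 := energy_nonneg α 0
    have h3 := energy_nonneg α T
    have h4 : |(∑ k, ‖α 0 k‖ ^ 2) - ∑ k, ‖α T k‖ ^ 2| ≤ M := by
      rw [abs_sub_le_iff]
      constructor <;> linarith
    calc |(∑ k, ‖α 0 k‖ ^ 2) - ∑ k, ‖α T k‖ ^ 2| / (2 * T) ≤ M / (2 * T) :=
          div_le_div_of_nonneg_right h4 (by positivity)
      _ ≤ M / T := div_le_div_of_nonneg_left hM0 hT (by linarith)
  have hlim : Tendsto (fun T : ℝ => M / T) atTop (𝓝 0) := tendsto_const_nhds.div_atTop tendsto_id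
  refine squeeze_zero_norm' ?_ hlim
  filter_upwards [eventually_gt_atTop (0 : ℝ)] with T hT
  rw [Real.norm_eq_abs]
  exact hb T hT

/-- **Long-time energy balance, `liminf` form**: `⟨D⟩⁻ = ⟨W⟩⁻` — the `liminf` long-time averages of
the dissipation and of the injected power of a Galerkin solution coincide (no mean mode, `ν > 0`;
Doering–Foias 2002, §2, (2.6)–(2.8) at the Galerkin level). [cite: DoeringFoias2002, §2] -/
theorem longTimeAvgInf_dissipation_eq (hα : IsGalerkinODESolution ν g c₀ α) (hν : 0 < ν)
    (hS : ∀ k ∈ S, -k ∈ S) (hS0 : (0 : d → ℤ) ∉ S) (hg : IsRealCoeff g) :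
    longTimeAvgInf (fun t => ν * (4 * Real.pi ^ 2 * ∑ k : ↥S, freqNormSq (k : d → ℤ) * ‖α t k‖ ^ 2)) =
      longTimeAvgInf (fun t => ∑ k, (inner ℂ (g k) (α t k)).re) := by
  unfold longTimeAvgInf
  have heq : timeMean (fun t => ν * (4 * Real.pi ^ 2 * ∑ k : ↥S, freqNormSq (k : d → ℤ) *
      ‖α t k‖ ^ 2)) =ᶠ[atTop] fun T => timeMean (fun t => ∑ k, (inner ℂ (g k) (α t k)).re) T +
        ((∑ k, ‖α 0 k‖ ^ 2) - ∑ k, ‖α T k‖ ^ 2) / (2 * T) :=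
    (eventually_gt_atTop (0 : ℝ)).mono fun T hT => hα.timeMean_dissipation_eq hS hg hT
  rw [liminf_congr heq]
  exact liminf_add_eq_of_tendsto_zero (hα.tendsto_energy_sub_div hν hS hS0 hg)
    (hα.isBoundedUnder_le_timeMean_work hν hS hS0 hg) (hα.isBoundedUnder_ge_timeMean_work hν hS hS0 hg)

/-- **Long-time energy balance, `limsup` form**: `⟨D⟩⁺ = ⟨W⟩⁺` (no mean mode, `ν > 0`;
Doering–Foias 2002, §2). [cite: DoeringFoias2002, §2] -/
theorem longTimeAvgSup_dissipation_eq (hα : IsGalerkinODESolution ν g c₀ α) (hν : 0 < ν)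
    (hS : ∀ k ∈ S, -k ∈ S) (hS0 : (0 : d → ℤ) ∉ S) (hg : IsRealCoeff g) :
    longTimeAvgSup (fun t => ν * (4 * Real.pi ^ 2 * ∑ k : ↥S, freqNormSq (k : d → ℤ) * ‖α t k‖ ^ 2)) =
      longTimeAvgSup (fun t => ∑ k, (inner ℂ (g k) (α t k)).re) := by
  unfold longTimeAvgSup
  have heq : timeMean (fun t => ν * (4 * Real.pi ^ 2 * ∑ k : ↥S, freqNormSq (k : d → ℤ) *
      ‖α t k‖ ^ 2)) =ᶠ[atTop] fun T => timeMean (fun t => ∑ k, (inner ℂ (g k) (α t k)).re) T +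
        ((∑ k, ‖α 0 k‖ ^ 2) - ∑ k, ‖α T k‖ ^ 2) / (2 * T) :=
    (eventually_gt_atTop (0 : ℝ)).mono fun T hT => hα.timeMean_dissipation_eq hS hg hT
  rw [limsup_congr heq]
  exact limsup_add_eq_of_tendsto_zero (hα.tendsto_energy_sub_div hν hS hS0 hg)
    (hα.isBoundedUnder_le_timeMean_work hν hS hS0 hg) (hα.isBoundedUnder_ge_timeMean_work hν hS hS0 hg)

/-! ### The energy row `⟨W⟩ ≤ G √⟨E⟩` -/

omit [DecidableEq d] in
/-- **Finite-time energy row**: `⟨W⟩_T ≤ G √⟨E⟩_T` for `T > 0`, `G = (∑‖g_k‖²)^{1/2}`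
(Cauchy–Schwarz in `k`, then in `t`). [folklore] -/
theorem timeMean_work_le (hα : IsGalerkinODESolution ν g c₀ α) {T : ℝ} (hT : 0 < T) :
    timeMean (fun t => ∑ k, (inner ℂ (g k) (α t k)).re) T ≤
      Real.sqrt (∑ k, ‖g k‖ ^ 2) * Real.sqrt (timeMean (fun t => ∑ k, ‖α t k‖ ^ 2) T) := by
  have hG2 : 0 ≤ ∑ k, ‖g k‖ ^ 2 := Finset.sum_nonneg fun k _ => sq_nonneg _
  have hsub : Ioc 0 T ⊆ Ici 0 := Ioc_subset_Icc_self.trans Icc_subset_Ici_self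
  have h1 : timeMean (fun t => ∑ k, (inner ℂ (g k) (α t k)).re) T ≤
      timeMean (fun t => |∑ k, (inner ℂ (g k) (α t k)).re|) T :=
    timeMean_mono_of_nonneg hT.le (fun t => abs_nonneg _)
      (integrableOn_Ioc_of_continuousOn_Ici hα.continuousOn_work.abs T) (fun t _ _ => le_abs_self _)
  have h2 : timeMean (fun t => |∑ k, (inner ℂ (g k) (α t k)).re|) T ≤
      Real.sqrt (timeMean (fun _ => ∑ k, ‖g k‖ ^ 2) T * timeMean (fun t => ∑ k, ‖α t k‖ ^ 2) T) :=
    timeMean_le_sqrt_timeMean_mul_timeMean hT (ae_of_all _ fun t => abs_nonneg _)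
      (ae_of_all _ fun t => hG2) (ae_of_all _ fun t => energy_nonneg α t)
      (ae_of_all _ fun t => by rw [sq_abs]; exact sum_re_inner_sq_le g (α t))
      ((hα.continuousOn_work.abs.mono hsub).aestronglyMeasurable measurableSet_Ioc)
      (integrableOn_const measure_Ioc_lt_top.ne)
      (integrableOn_Ioc_of_continuousOn_Ici hα.continuousOn_energy T)
  rw [timeMean_const hT, Real.sqrt_mul hG2] at h2
  exact h1.trans h2

/-- **Long-time energy row**: `⟨W⟩⁺ ≤ G √⟨E⟩⁺` (no mean mode, `ν > 0`; the `√·` commutes with the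
`limsup` of the bounded energy means). [cite: DoeringFoias2002, §2] -/
theorem longTimeAvgSup_work_le (hα : IsGalerkinODESolution ν g c₀ α) (hν : 0 < ν)
    (hS : ∀ k ∈ S, -k ∈ S) (hS0 : (0 : d → ℤ) ∉ S) (hg : IsRealCoeff g) :
    longTimeAvgSup (fun t => ∑ k, (inner ℂ (g k) (α t k)).re) ≤
      Real.sqrt (∑ k, ‖g k‖ ^ 2) * Real.sqrt (longTimeAvgSup fun t => ∑ k, ‖α t k‖ ^ 2) := by
  unfold longTimeAvgSup
  set mE := timeMean fun t => ∑ k, ‖α t k‖ ^ 2 with hmE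
  have hφ : Monotone fun x : ℝ => Real.sqrt (∑ k, ‖g k‖ ^ 2) * Real.sqrt x :=
    fun x y hxy => mul_le_mul_of_nonneg_left (Real.sqrt_le_sqrt hxy) (Real.sqrt_nonneg _)
  have hφc : Continuous fun x : ℝ => Real.sqrt (∑ k, ‖g k‖ ^ 2) * Real.sqrt x :=
    continuous_const.mul Real.continuous_sqrt
  have hEb := hα.isBoundedUnder_le_timeMean_energy hν hS hS0 hg
  have hEb' := isBoundedUnder_ge_timeMean_energy α
  have hmap : Real.sqrt (∑ k, ‖g k‖ ^ 2) * Real.sqrt (limsup mE atTop) =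
      limsup ((fun x : ℝ => Real.sqrt (∑ k, ‖g k‖ ^ 2) * Real.sqrt x) ∘ mE) atTop :=
    hφ.map_limsup_of_continuousAt mE hφc.continuousAt hEb hEb'.isCoboundedUnder_le
  rw [hmap]
  refine limsup_le_limsup ?_ (hα.isBoundedUnder_ge_timeMean_work hν hS hS0 hg).isCoboundedUnder_le ?_
  · filter_upwards [eventually_gt_atTop (0 : ℝ)] with T hT
    exact hα.timeMean_work_le hT
  · obtain ⟨B, hB⟩ := hEb
    refine ⟨Real.sqrt (∑ k, ‖g k‖ ^ 2) * Real.sqrt B, ?_⟩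
    rw [eventually_map] at hB ⊢
    exact hB.mono fun T hT => hφ hT

/-- **Budgets are not free**: a trajectory with `⟨E⟩⁺ ≤ E₀` and `⟨D⟩⁻ ≥ ε` has `ε ≤ G √E₀`
(no mean mode, `ν > 0`): `ε ≤ ⟨D⟩⁻ ≤ ⟨D⟩⁺ = ⟨W⟩⁺ ≤ G √⟨E⟩⁺ ≤ G √E₀`. [folklore] -/
theorem le_sqrt_mul_sqrt_of_floor (hα : IsGalerkinODESolution ν g c₀ α) (hν : 0 < ν)
    (hS : ∀ k ∈ S, -k ∈ S) (hS0 : (0 : d → ℤ) ∉ S) (hg : IsRealCoeff g) {E₀ ε : ℝ}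
    (hE : longTimeAvgSup (fun t => ∑ k, ‖α t k‖ ^ 2) ≤ E₀)
    (hε : ε ≤ longTimeAvgInf
      (fun t => ν * (4 * Real.pi ^ 2 * ∑ k : ↥S, freqNormSq (k : d → ℤ) * ‖α t k‖ ^ 2))) :
    ε ≤ Real.sqrt (∑ k, ‖g k‖ ^ 2) * Real.sqrt E₀ := by
  have h1 : longTimeAvgInf
      (fun t => ν * (4 * Real.pi ^ 2 * ∑ k : ↥S, freqNormSq (k : d → ℤ) * ‖α t k‖ ^ 2)) ≤
        longTimeAvgSup
          (fun t => ν * (4 * Real.pi ^ 2 * ∑ k : ↥S, freqNormSq (k : d → ℤ) * ‖α t k‖ ^ 2)) :=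
    liminf_le_limsup (hα.isBoundedUnder_le_timeMean_dissipation hν hS hS0 hg)
      (isBoundedUnder_ge_timeMean_dissipation hν.le α)
  have h2 := hα.longTimeAvgSup_dissipation_eq hν hS hS0 hg
  have h3 := hα.longTimeAvgSup_work_le hν hS hS0 hg
  have h4 : Real.sqrt (∑ k, ‖g k‖ ^ 2) * Real.sqrt (longTimeAvgSup fun t => ∑ k, ‖α t k‖ ^ 2) ≤
      Real.sqrt (∑ k, ‖g k‖ ^ 2) * Real.sqrt E₀ :=
    mul_le_mul_of_nonneg_left (Real.sqrt_le_sqrt hE) (Real.sqrt_nonneg _)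
  linarith

/-! ### Cone ⇒ window -/

/-- **A floor on one observable gives both clauses.**  If the running means of the single observable
`Φ_λ = D − λE` (`λ > 0`) have `liminf ≥ δ > 0`, then `⟨E⟩⁺ ≤ (∑‖g_k‖²)/λ²` and `⟨D⟩⁻ ≥ δ`
(no mean mode, `ν > 0`; energy row + long-time balance). [folklore] -/
theorem window_of_cone (hα : IsGalerkinODESolution ν g c₀ α) (hν : 0 < ν)
    (hS : ∀ k ∈ S, -k ∈ S) (hS0 : (0 : d → ℤ) ∉ S) (hg : IsRealCoeff g) {lam δ : ℝ}
    (hlam : 0 < lam) (hδ : 0 < δ)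
    (hcone : δ ≤ longTimeAvgInf (fun t =>
      ν * (4 * Real.pi ^ 2 * ∑ k : ↥S, freqNormSq (k : d → ℤ) * ‖α t k‖ ^ 2) -
        lam * ∑ k, ‖α t k‖ ^ 2)) :
    longTimeAvgSup (fun t => ∑ k, ‖α t k‖ ^ 2) ≤ (∑ k, ‖g k‖ ^ 2) / lam ^ 2 ∧
      δ ≤ longTimeAvgInf
        (fun t => ν * (4 * Real.pi ^ 2 * ∑ k : ↥S, freqNormSq (k : d → ℤ) * ‖α t k‖ ^ 2)) := by
  have hG2 : 0 ≤ ∑ k, ‖g k‖ ^ 2 := Finset.sum_nonneg fun k _ => sq_nonneg _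
  set M : ℝ := max (∑ k, ‖α 0 k‖ ^ 2) ((∑ k, ‖g k‖ ^ 2) / (4 * Real.pi ^ 2 * ν) ^ 2) with hM
  have hDint := fun T => integrableOn_Ioc_of_continuousOn_Ici hα.continuousOn_dissipation T
  have hEint := fun T => integrableOn_Ioc_of_continuousOn_Ici hα.continuousOn_energy T
  -- the means of `Φ` split
  have h1 : ∀ᶠ T in atTop, timeMean (fun t =>
      ν * (4 * Real.pi ^ 2 * ∑ k : ↥S, freqNormSq (k : d → ℤ) * ‖α t k‖ ^ 2) -
        lam * ∑ k, ‖α t k‖ ^ 2) T =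
      timeMean (fun t => ν * (4 * Real.pi ^ 2 * ∑ k : ↥S, freqNormSq (k : d → ℤ) * ‖α t k‖ ^ 2)) T -
        lam * timeMean (fun t => ∑ k, ‖α t k‖ ^ 2) T := by
    filter_upwards [eventually_ge_atTop (0 : ℝ)] with T hT
    rw [timeMean_sub hT (hDint T) ((hEint T).const_mul lam),
      timeMean_const_mul lam (fun t => ∑ k, ‖α t k‖ ^ 2) T]
  have h2 : ∀ᶠ T in atTop,
      timeMean (fun t => ν * (4 * Real.pi ^ 2 * ∑ k : ↥S, freqNormSq (k : d → ℤ) * ‖α t k‖ ^ 2)) T =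
        timeMean (fun t => ∑ k, (inner ℂ (g k) (α t k)).re) T +
          ((∑ k, ‖α 0 k‖ ^ 2) - ∑ k, ‖α T k‖ ^ 2) / (2 * T) :=
    (eventually_gt_atTop (0 : ℝ)).mono fun T hT => hα.timeMean_dissipation_eq hS hg hT
  have h3 : ∀ᶠ T in atTop, timeMean (fun t => ∑ k, (inner ℂ (g k) (α t k)).re) T ≤
      Real.sqrt (∑ k, ‖g k‖ ^ 2) * Real.sqrt (timeMean (fun t => ∑ k, ‖α t k‖ ^ 2) T) :=
    (eventually_gt_atTop (0 : ℝ)).mono fun T hT => hα.timeMean_work_le hT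
  have h4 : ∀ᶠ T in atTop, 0 ≤ timeMean (fun t => ∑ k, ‖α t k‖ ^ 2) T :=
    (eventually_ge_atTop (0 : ℝ)).mono fun T hT => timeMean_nonneg (energy_nonneg α) hT
  -- `Φ` is bounded along the solution, hence so are its means
  have hΦb : IsBoundedUnder (· ≥ ·) atTop (timeMean fun t =>
      ν * (4 * Real.pi ^ 2 * ∑ k : ↥S, freqNormSq (k : d → ℤ) * ‖α t k‖ ^ 2) -
        lam * ∑ k, ‖α t k‖ ^ 2) := by
    refine isBoundedUnder_ge_timeMean
      (C := ν * (4 * Real.pi ^ 2 * ∑ k' ∈ S, freqNormSq k') * M + lam * M) fun t ht => ?_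
    have hD0 := dissipation_nonneg hν.le α t
    have hD1 := hα.dissipation_le hν hS hS0 hg ht.le
    have hE0 := energy_nonneg α t
    have hE1 := hα.energy_le_max hν hS hS0 hg ht.le
    rw [← hM] at hD1 hE1
    rw [abs_le]
    constructor <;> nlinarith
  exact limsup_le_and_le_liminf_of_cone hlam hδ hG2 h1 h2 h3 h4
    (hα.isBoundedUnder_le_timeMean_energy hν hS hS0 hg) hΦb
    (hα.isBoundedUnder_le_timeMean_dissipation hν hS hS0 hg) (hα.tendsto_energy_sub_div hν hS hS0 hg)
    hcone

end IsGalerkinODESolution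

end Balance

end Literature.Analysis.FluidPDE

end
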